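import Mathlib
import Literature.AlgebraicGeometry.HyperbolicPolynomials.HyperbolicityCone
import Literature.AlgebraicGeometry.HyperbolicPolynomials.Garding

/-!
# `PermanentalConeHard` (stmt-ValiantsHypothesis-8654), line `birth` — facet-contact obstruction II

Route `PermanentalCones` of `ValiantsHypothesis`, crux `PermanentalConeHard`, stub
`stub_hyperplaneContactVanishing`: the hyperbolic-cone-geometry half of the NO-GO theorem for the
"facet-contact" strategy.  Let `q` be a form hyperbolic w.r.t. `e`, `Λ₊ = hyperbolicityCone q e`
its closed hyperbolicity cone and `ℓ ≠ 0` a supporting functional (`ℓ ⬝ x ≥ 0` on `Λ₊`).  If `ℓ`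
is tight (`ℓ ⬝ p_l = 0`) at cone points `p_l ∈ Λ₊` spanning the whole hyperplane `ker ℓ`, then
`q` vanishes on a nonempty relatively open piece `U ∩ ker ℓ` of that hyperplane.

Proof.
* `ContactVanishing.eval_eq_zero_of_dotProduct_eq_zero` (boundary zeros): a cone point `x ∈ Λ₊`
  with `ℓ ⬝ x = 0` is a zero of `q` — otherwise `x` lies in the open cone `Λ₊₊`
  (`mem_openHyperbolicityCone_of_eval_ne_zero`), which is open (Gårding), so `x - s • ℓ ∈ Λ₊` for
  some `s > 0`, whereas `ℓ ⬝ (x - s • ℓ) = -s (ℓ ⬝ ℓ) < 0`.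
* `ContactVanishing.sum_smul_mem_hyperbolicityCone`: `Λ₊` is a convex cone, so nonnegative
  combinations `∑ t_l • p_l` of cone points stay in `Λ₊`.
* `ContactVanishing.exists_isOpen_image_linearCombination` (open mapping): the combination map
  `T : t ↦ ∑ t_l • p_l`, corestricted to its finite-dimensional range `H = span {p_l}`, is
  surjective, hence open (`LinearMap.isOpenMap_of_finiteDimensional`); so the image of the open
  orthant `{t | ∀ l, 0 < t_l}` is the trace `U ∩ H` of an open set `U` of the ambient space.
  Then `x₀ = ∑ p_l = T 1 ∈ U ∩ ker ℓ`, and every `x ∈ U ∩ ker ℓ ⊆ U ∩ H` is a positive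
  combination of the `p_l`, hence in `Λ₊`, hence a zero of `q` by the first step.

References: folklore (the cone facts used — convexity, openness of `Λ₊₊`, scaling — are
L. Gårding, *An inequality for hyperbolic polynomials*, J. Math. Mech. 8 (1959), Thm 2, and
J. Renegar, *Hyperbolic programs, and their derivative relaxations*, Found. Comput. Math. 6 (2006),
§2, all taken from the `Literature` tree).
-/

set_option linter.dupNamespace false

namespace Summit.ValiantsHypothesis.ValiantsHypothesis.Theorems.PermanentalConesPermanentalConeHard

open MvPolynomial Filter Topology
open scoped BigOperators
open Literature.AlgebraicGeometry.HyperbolicPolynomials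

namespace ContactVanishing

variable {σ : Type*} {f : MvPolynomial σ ℝ} {d : ℕ} {e : σ → ℝ}

/-! ### The closed hyperbolicity cone is a convex cone -/

/-- `Λ₊` is closed under addition: `x + y = 2 • (½ • x + ½ • y)`, convexity (Gårding) and positive
scaling. [folklore] -/
theorem add_mem_hyperbolicityCone (hf : f.IsHomogeneous d) (he : IsHyperbolic f e) {x y : σ → ℝ}
    (hx : x ∈ hyperbolicityCone f e) (hy : y ∈ hyperbolicityCone f e) :
    x + y ∈ hyperbolicityCone f e := by
  have h : (1 / 2 : ℝ) • x + (1 / 2 : ℝ) • y ∈ hyperbolicityCone f e :=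
    convex_hyperbolicityCone hf he hx hy (by norm_num) (by norm_num) (by norm_num)
  have h2 := smul_mem_hyperbolicityCone hf h (by norm_num : (0 : ℝ) < 2)
  rwa [smul_add, smul_smul, smul_smul, show (2 : ℝ) * (1 / 2) = 1 by norm_num, one_smul,
    one_smul] at h2

/-- Nonnegative combinations of points of `Λ₊` lie in `Λ₊` (`Λ₊` is a convex cone containing the
origin). [folklore] -/
theorem sum_smul_mem_hyperbolicityCone (hf : f.IsHomogeneous d) (he : IsHyperbolic f e)
    {ι : Type*} (s : Finset ι) {p : ι → σ → ℝ} {t : ι → ℝ}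
    (hp : ∀ i ∈ s, p i ∈ hyperbolicityCone f e) (ht : ∀ i ∈ s, 0 ≤ t i) :
    ∑ i ∈ s, t i • p i ∈ hyperbolicityCone f e := by
  refine Finset.sum_induction _ (· ∈ hyperbolicityCone f e)
    (fun _ _ ha hb => add_mem_hyperbolicityCone hf he ha hb)
    (zero_mem_hyperbolicityCone hf he.eval_ne_zero) fun i hi => ?_
  rcases (ht i hi).eq_or_lt with h | h
  · rw [← h, zero_smul]
    exact zero_mem_hyperbolicityCone hf he.eval_ne_zero
  · exact smul_mem_hyperbolicityCone hf (hp i hi) h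

/-! ### Boundary zeros: tight supporting functionals -/

/-- **Boundary zeros.** If `ℓ ≠ 0` is nonnegative on `Λ₊` and tight at a cone point `x ∈ Λ₊`
(`ℓ ⬝ x = 0`), then `f x = 0`: otherwise `x ∈ Λ₊₊`, which is open, so `x - s • ℓ ∈ Λ₊` for some
`s > 0`, but `ℓ ⬝ (x - s • ℓ) = -s (ℓ ⬝ ℓ) < 0`. [folklore] -/
theorem eval_eq_zero_of_dotProduct_eq_zero [Fintype σ] (hf : f.IsHomogeneous d)
    (he : IsHyperbolic f e) {ℓ : σ → ℝ} (hℓ : ℓ ≠ 0)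
    (hℓnn : ∀ y ∈ hyperbolicityCone f e, 0 ≤ ℓ ⬝ᵥ y) {x : σ → ℝ}
    (hx : x ∈ hyperbolicityCone f e) (hℓx : ℓ ⬝ᵥ x = 0) : MvPolynomial.eval x f = 0 := by
  by_contra hx0
  have hxo : x ∈ openHyperbolicityCone f e := mem_openHyperbolicityCone_of_eval_ne_zero hx hx0
  have htd : Tendsto (fun s : ℝ => x - s • ℓ) (𝓝[>] 0) (𝓝 x) := by
    have : Continuous fun s : ℝ => x - s • ℓ :=
      continuous_const.sub (continuous_id.smul continuous_const)
    simpa using (this.tendsto 0).mono_left nhdsWithin_le_nhds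
  obtain ⟨s, hs, hspos⟩ :=
    ((htd.eventually ((he.isOpen_openHyperbolicityCone hf).mem_nhds hxo)).and
      self_mem_nhdsWithin).exists
  have h1 := hℓnn _ (openHyperbolicityCone_subset f e hs)
  rw [dotProduct_sub, dotProduct_smul, hℓx, smul_eq_mul, zero_sub] at h1
  have h0 : 0 ≤ ℓ ⬝ᵥ ℓ := Finset.sum_nonneg fun i _ => mul_self_nonneg (ℓ i)
  have hpos : 0 < ℓ ⬝ᵥ ℓ :=
    lt_of_le_of_ne h0 fun h => hℓ (dotProduct_self_eq_zero.1 h.symm)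
  have hs0 : (0 : ℝ) < s := hspos
  nlinarith [mul_pos hs0 hpos]

/-! ### Positive combinations form a relatively open subset of the span -/

/-- **Open mapping onto the span.** For a finite family `p : ι → E` in a Hausdorff topological
vector space and an open set `V` of coefficient vectors, the set of combinations
`{∑ t_i • p_i | t ∈ V}` is relatively open in `span p`: it is contained in an open set `U` of `E`
whose trace on `span p` lies in it.  (The combination map corestricted to its finite-dimensional
range is surjective, hence open — `LinearMap.isOpenMap_of_finiteDimensional` — and an open subset
of a subspace is the trace of an open set.) [folklore] -/
theorem exists_isOpen_image_linearCombination {ι : Type*} [Fintype ι] {E : Type*}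
    [AddCommGroup E] [Module ℝ E] [TopologicalSpace E] [IsTopologicalAddGroup E]
    [ContinuousSMul ℝ E] [T2Space E] (p : ι → E) {V : Set (ι → ℝ)} (hV : IsOpen V) :
    ∃ U : Set E, IsOpen U ∧ Fintype.linearCombination ℝ p '' V ⊆ U ∧
      ∀ x ∈ U, x ∈ Submodule.span ℝ (Set.range p) → x ∈ Fintype.linearCombination ℝ p '' V := by
  obtain ⟨U, hU, hUV⟩ := isOpen_induced_iff.1
    (((Fintype.linearCombination ℝ p).rangeRestrict.isOpenMap_of_finiteDimensional
      (LinearMap.surjective_rangeRestrict _)) V hV)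
  refine ⟨U, hU, ?_, fun x hxU hx => ?_⟩
  · rintro _ ⟨t, ht, rfl⟩
    have h : (Fintype.linearCombination ℝ p).rangeRestrict t ∈ Subtype.val ⁻¹' U := by
      rw [hUV]
      exact Set.mem_image_of_mem _ ht
    exact h
  · rw [← Fintype.range_linearCombination] at hx
    have h : (⟨x, hx⟩ : LinearMap.range (Fintype.linearCombination ℝ p)) ∈ Subtype.val ⁻¹' U :=
      hxU
    rw [hUV] at h
    obtain ⟨t, ht, htx⟩ := h
    exact ⟨t, ht, congrArg Subtype.val htx⟩

end ContactVanishing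

/-- **Facet-contact obstruction, part II (hyperplane contact forces vanishing).**  Let `q` be a
form hyperbolic w.r.t. `e` with closed hyperbolicity cone `Λ₊ = hyperbolicityCone q e`, and let
`ℓ ≠ 0` be nonnegative on `Λ₊`.  If `ℓ` is tight at cone points `p_l ∈ Λ₊` (`ℓ ⬝ p_l = 0`) which
span the hyperplane `ker ℓ`, then there is an open set `U` meeting `ker ℓ` such that `q` vanishes
on `U ∩ ker ℓ`: the positive combinations of the `p_l` form a relatively open subset of `ker ℓ`
(`ContactVanishing.exists_isOpen_image_linearCombination`) consisting of cone points
(`ContactVanishing.sum_smul_mem_hyperbolicityCone`) at which `ℓ` is tight, hence of zeros of `q`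
(`ContactVanishing.eval_eq_zero_of_dotProduct_eq_zero`). [folklore] -/
theorem stub_hyperplaneContactVanishing : ∀ (σ : Type) [Fintype σ] [DecidableEq σ] (d : ℕ) (q : MvPolynomial σ ℝ) (e : σ → ℝ), q.IsHomogeneous d → IsHyperbolic q e → ∀ (ℓ : σ → ℝ), ℓ ≠ 0 → (∀ x ∈ hyperbolicityCone q e, 0 ≤ dotProduct ℓ x) → ∀ (L : ℕ) (p : Fin L → σ → ℝ), (∀ l, p l ∈ hyperbolicityCone q e) → (∀ l, dotProduct ℓ (p l) = 0) → (∀ x : σ → ℝ, dotProduct ℓ x = 0 → x ∈ Submodule.span ℝ (Set.range p)) → ∃ U : Set (σ → ℝ), IsOpen U ∧ (∃ x ∈ U, dotProduct ℓ x = 0) ∧ ∀ x ∈ U, dotProduct ℓ x = 0 → MvPolynomial.eval x q = 0 := by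
  intro σ _ _ d q e hq he ℓ hℓ hℓnn L p hp hpℓ hspan
  obtain ⟨U, hU, hsub, hback⟩ := ContactVanishing.exists_isOpen_image_linearCombination p
    (isOpen_set_pi Set.finite_univ fun (_ : Fin L) _ => (isOpen_Ioi : IsOpen (Set.Ioi (0 : ℝ))))
  refine ⟨U, hU, ⟨Fintype.linearCombination ℝ p fun _ => 1, hsub ⟨_, ?_, rfl⟩, ?_⟩, ?_⟩
  · exact Set.mem_univ_pi.2 fun _ => Set.mem_Ioi.2 one_pos
  · rw [Fintype.linearCombination_apply, dotProduct_sum]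
    exact Finset.sum_eq_zero fun l _ => by rw [dotProduct_smul, hpℓ l, smul_zero]
  · intro x hxU hxℓ
    obtain ⟨t, ht, rfl⟩ := hback x hxU (hspan x hxℓ)
    refine ContactVanishing.eval_eq_zero_of_dotProduct_eq_zero hq he hℓ hℓnn ?_ hxℓ
    rw [Fintype.linearCombination_apply]
    exact ContactVanishing.sum_smul_mem_hyperbolicityCone hq he _ (fun l _ => hp l)
      fun l _ => (Set.mem_Ioi.1 (Set.mem_univ_pi.1 ht l)).le

end Summit.ValiantsHypothesis.ValiantsHypothesis.Theorems.PermanentalConesPermanentalConeHard
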